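import Summits.KontsevichZagierPeriods.KontsevichZagierPeriods.Theorems.RootDecompWalshStrataConicEllipse

/-!
# Conic descent 6/7: chart (c2) and the reflection about the vertex

Chart (c2) `e > 0`, `h = g − f²/(4e) > 0`: `x = x₀ + 2√h·t/(e − t²)` on the `ℚ`-semialgebraic set
`{t² < e}` pulls `γ√D` back to `2γh(e + t²)²/(e − t²)³` (`sqrtDescent_hyperbola_in`).  For `e ≠ 0`,
`h ≤ 0`: `qD_reflect` (symmetry `x ↦ 2x₀ − x`, `x₀ = −f/(2e) ∈ ℚ`), `InBaker.of_reflect` (the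
reflection is a rational rule-(2) chart) and **`InBaker.split_reflect`**: it suffices to treat
representations living on `{x > x₀} ∩ {D > 0}` (the vertex fibre is null, the left piece reflects).
Imports: part 5; 0 sorry. [KontsevichZagier2001 §1.2; BCR1998 §2.2]
-/

noncomputable section

open Literature.NumberTheory.Transcendental
open MeasureTheory Set
open MvPolynomial (aeval X C)
open Literature.ModelTheory.ExponentialFields (IsSemialgebraic isSemialgebraic_univ
  isSemialgebraic_setOf_eval_pos isSemialgebraic_setOf_eval_lt isSemialgebraic_setOf_eval_le
  isSemialgebraic_setOf_eval_nonneg isSemialgebraic_setOf_eval_eq_zero continuous_aeval_real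
  tarski_seidenberg_real_holds)
open Summit.KontsevichZagierPeriods.RootDecompWalshStrata.WalshSpanProof (isSemialgebraic_cubeSet
  isBounded_cubeSet)
open Summit.KontsevichZagierPeriods.RootDecompWalshStrata.ConeSpecimen (unitIoo isSemialgebraic_unitIoo
  unitIoo_subset_Icc mem_unitIoo)

namespace Summit.KontsevichZagierPeriods.RootDecompWalshStrata.ConicDescent

/-! #### 15. Chart (c2): `e > 0`, `h > 0` — `x = x₀ + 2√h·t/(e − t²)` -/

/-- The derivative of `s ↦ s²` at `t` is `2t` (file-local copy). [folklore] -/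
private theorem hasDerivAt_sq (t : ℝ) : HasDerivAt (fun s : ℝ => s ^ 2) (2 * t) t := by
  simpa using hasDerivAt_pow 2 t

/-- The chart domain `{t | t² < e}` is `ℚ`-semialgebraic. [BCR1998 §2.2] -/
theorem isSemialgebraic_T_sq_lt (e : ℚ) : IsSemialgebraic ℚ {v : Fin 1 → ℝ | v 0 ^ 2 < e} := by
  convert isSemialgebraic_setOf_eval_pos (k := ℚ) (R := ℝ)
    (MvPolynomial.C e - MvPolynomial.X (0 : Fin 1) ^ 2 : MvPolynomial (Fin 1) ℚ) using 1
  ext v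
  simp [sub_pos]

/-- `γ√(e x² + f x + g)` with `e > 0`, `h = g − f²/(4e) > 0`: the substitution
`x = x₀ + 2√h·t/(e − t²)`, `t² < e`, pulls the integrand back to `2γh(e + t²)²/(e − t²)³`.
[this node] -/
theorem sqrtDescent_hyperbola_in (e f g γ : ℚ) (he : 0 < e) (hh : 0 < g - f ^ 2 / (4 * e)) :
    SqrtDescent e f g γ := by
  intro r hr
  have he0 : (0 : ℝ) < e := by exact_mod_cast he
  have hh0 : (0 : ℝ) < ((g - f ^ 2 / (4 * e) : ℚ) : ℝ) := by exact_mod_cast hh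
  set H : ℝ := ((g - f ^ 2 / (4 * e) : ℚ) : ℝ) with hHdef
  set X₀ : ℝ := ((-f / (2 * e) : ℚ) : ℝ) with hX₀def
  have hHe : H = g - f ^ 2 / (4 * e) := by rw [hHdef]; push_cast; ring
  have hX₀e : X₀ = -f / (2 * e) := by rw [hX₀def]; push_cast; ring
  set a : ℝ := √H with hadef
  have ha : 0 < a := Real.sqrt_pos.2 hh0
  have ha2 : a ^ 2 = H := Real.sq_sqrt hh0.le
  have hG : (g : ℝ) = a ^ 2 + f ^ 2 / (4 * e) := by rw [ha2, hHe]; ring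
  have hE : ∀ v : Fin 1 → ℝ, v ∈ {v : Fin 1 → ℝ | v 0 ^ 2 < e} → 0 < (e : ℝ) - v 0 ^ 2 :=
    fun v hv => sub_pos.2 hv
  -- the chart
  set gφ : ℝ → ℝ := fun s => X₀ + 2 * a * (s / (e - s ^ 2)) with hgdef
  set g' : ℝ → ℝ := fun s => 2 * a * (e + s ^ 2) / (e - s ^ 2) ^ 2 with hg'def
  have haq : ∀ v : Fin 1 → ℝ, aeval v ((MvPolynomial.C e - MvPolynomial.X 0 ^ 2) ^ 3 :
      MvPolynomial (Fin 1) ℚ) = ((e : ℝ) - v 0 ^ 2) ^ 3 := fun v => by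
    simp only [map_pow, map_sub, MvPolynomial.aeval_C, MvPolynomial.aeval_X, eq_ratCast]
  have hap : ∀ v : Fin 1 → ℝ, aeval v (MvPolynomial.C (2 * γ * (g - f ^ 2 / (4 * e))) *
      (MvPolynomial.C e + MvPolynomial.X 0 ^ 2) ^ 2 : MvPolynomial (Fin 1) ℚ) =
      2 * γ * H * ((e : ℝ) + v 0 ^ 2) ^ 2 := fun v => by
    simp only [map_pow, map_add, map_mul, MvPolynomial.aeval_C, MvPolynomial.aeval_X, eq_ratCast,
      hHdef]
    push_cast
    ring
  refine InBaker.of_cov₁ r (isSemialgebraic_T_sq_lt e) gφ g' ?_ ?_ ?_ ?_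
    (MvPolynomial.C (2 * γ * (g - f ^ 2 / (4 * e))) * (MvPolynomial.C e + MvPolynomial.X 0 ^ 2) ^ 2)
    ((MvPolynomial.C e - MvPolynomial.X 0 ^ 2) ^ 3)
    (fun v hv => by rw [haq]; exact pow_ne_zero 3 (hE v hv).ne') fun v hv hvd => ?_
  · -- semialgebraic
    have hq : IsSemialgebraicFunOn ℚ {v : Fin 1 → ℝ | v 0 ^ 2 < e} fun v => v 0 / (e - v 0 ^ 2) :=
      (isSemialgebraicFunOn_aeval_div_aeval (isSemialgebraic_T_sq_lt e) (MvPolynomial.X 0)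
        (MvPolynomial.C e - MvPolynomial.X 0 ^ 2) fun v hv => by
          simp only [map_sub, map_pow, MvPolynomial.aeval_C, MvPolynomial.aeval_X, eq_ratCast]
          exact (hE v hv).ne').congr fun v _ => by
        simp only [map_sub, map_pow, MvPolynomial.aeval_C, MvPolynomial.aeval_X, eq_ratCast]
    have hc : IsSemialgebraicFunOn ℚ {v : Fin 1 → ℝ | v 0 ^ 2 < e} fun _ => 2 * a :=
      ((isSemialgebraicFunOn_ratCast (isSemialgebraic_T_sq_lt e) 2).mul_holds
        (IsSemialgebraicFunOn.sqrt_holds (isSemialgebraicFunOn_ratCast (isSemialgebraic_T_sq_lt e)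
        (g - f ^ 2 / (4 * e))))).congr fun v _ => by
          simp only [Pi.mul_apply, hadef, hHdef]; push_cast; ring_nf
    exact ((isSemialgebraicFunOn_ratCast (isSemialgebraic_T_sq_lt e) (-f / (2 * e))).add_holds
      (hc.mul_holds hq)).congr fun v _ => by
        simp only [hgdef, hX₀def, Pi.add_apply, Pi.mul_apply]
  · -- derivative
    intro v hv
    have h1 : HasDerivAt (fun s : ℝ => (e : ℝ) - s ^ 2) (-(2 * v 0)) (v 0) :=
      (hasDerivAt_sq (v 0)).const_sub (e : ℝ)
    have h2 := (((hasDerivAt_id (v 0)).div h1 (hE v hv).ne').const_mul (2 * a)).const_add X₀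
    refine h2.congr_deriv ?_
    have hd := (hE v hv).ne'
    simp only [hg'def, id]
    field_simp
    ring
  · -- injective on `t² < e`
    intro s hs t ht hst
    have hs' : s 0 ^ 2 < e := hs
    have ht' : t 0 ^ 2 < e := ht
    have h1 : s 0 / (e - s 0 ^ 2) = t 0 / (e - t 0 ^ 2) := by
      have h' : X₀ + 2 * a * (s 0 / (e - s 0 ^ 2)) = X₀ + 2 * a * (t 0 / (e - t 0 ^ 2)) := hst
      exact mul_left_cancel₀ (by positivity) (add_left_cancel h')
    rw [div_eq_div_iff (hE s hs).ne' (hE t ht).ne'] at h1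
    have h2 : (s 0 - t 0) * ((e : ℝ) + s 0 * t 0) = 0 := by linear_combination h1
    rcases mul_eq_zero.1 h2 with h3 | h3
    · linarith
    · nlinarith [sq_nonneg (s 0 + t 0)]
  · -- surjective (onto everything)
    intro x _
    obtain ⟨u, hudef⟩ : ∃ u : ℝ, u = x 0 - X₀ := ⟨_, rfl⟩
    have hHu : 0 < H + e * u ^ 2 := by positivity
    obtain ⟨S, hSdef⟩ : ∃ S : ℝ, S = √(H + e * u ^ 2) := ⟨_, rfl⟩
    have hS : 0 < S := by rw [hSdef]; exact Real.sqrt_pos.2 hHu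
    have hS2 : S ^ 2 = H + e * u ^ 2 := by rw [hSdef]; exact Real.sq_sqrt hHu.le
    obtain ⟨d, hddef⟩ : ∃ d : ℝ, d = a + S := ⟨_, rfl⟩
    have hd : 0 < d := by rw [hddef]; exact add_pos ha hS
    have hd0 : d ≠ 0 := hd.ne'
    have hd2 : d ^ 2 - e * u ^ 2 = 2 * a * d := by
      rw [hddef]
      linear_combination hS2 - ha2
    obtain ⟨t, htdef⟩ : ∃ t : ℝ, t = e * u / d := ⟨_, rfl⟩
    have het : (e : ℝ) - t ^ 2 = 2 * e * a / d := by
      have h1 : (e : ℝ) - t ^ 2 = e * (d ^ 2 - e * u ^ 2) / d ^ 2 := by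
        rw [htdef]
        field_simp
      rw [h1, hd2]
      field_simp
    have het0 : 0 < (e : ℝ) - t ^ 2 := by rw [het]; positivity
    refine ⟨fun _ => t, by simpa [sub_pos] using het0, ?_⟩
    change X₀ + 2 * a * (t / (e - t ^ 2)) = x 0
    have hea : (2 : ℝ) * e * a ≠ 0 := by positivity
    rw [het, htdef]
    field_simp
    rw [hudef]
    ring
  · -- the pulled-back integrand
    have hEv := hE v hv
    have hd : (e : ℝ) - v 0 ^ 2 ≠ 0 := hEv.ne'
    have hnum : 0 < a * ((e : ℝ) + v 0 ^ 2) / (e - v 0 ^ 2) := by positivity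
    have hWv : (e : ℝ) * (gφ (v 0)) ^ 2 + f * gφ (v 0) + g =
        (a * ((e : ℝ) + v 0 ^ 2) / (e - v 0 ^ 2)) ^ 2 := by
      simp only [hgdef]
      rw [hG, hX₀e]
      field_simp
      ring
    have hsq : √((e : ℝ) * (gφ (v 0)) ^ 2 + f * gφ (v 0) + g) =
        a * ((e : ℝ) + v 0 ^ 2) / (e - v 0 ^ 2) := by
      rw [hWv, Real.sqrt_sq hnum.le]
    have habs : |g' (v 0)| = 2 * a * (e + v 0 ^ 2) / (e - v 0 ^ 2) ^ 2 := by
      simp only [hg'def]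
      exact abs_of_pos (by positivity)
    rw [hr hvd]
    have hlift : lift₁ gφ v 0 = gφ (v 0) := rfl
    simp only [hlift, hap, haq]
    rw [hsq, habs, ← ha2]
    field_simp

/-! #### 16. Reflection about the vertex and the sign split (for `e > 0`, `h ≤ 0`) -/

/-- `D` is symmetric about `x₀ = −f/(2e)`. -/
theorem qD_reflect (e f g : ℚ) (he : e ≠ 0) (t : ℝ) :
    qD e f g (2 * (((-f / (2 * e) : ℚ) : ℝ)) - t) = qD e f g t := by
  rw [qD_eq_vertex e f g he, qD_eq_vertex e f g he]
  ring

/-- Reflection `x = 2x₀ − t` (rule (2), `|det| = 1`): `[r', γ√D]` is equivalent to a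
representation with the same integrand form on the mirror-image domain. [this node] -/
theorem InBaker.of_reflect (e f g γ : ℚ) (he : e ≠ 0) (r' : KZ.IntegralRep 1)
    (hr' : EqOn r'.integrand (fun v => (γ : ℝ) * √(qD e f g (v 0))) r'.domain)
    (h : ∀ r : KZ.IntegralRep 1,
      (∀ v ∈ r.domain, (fun _ : Fin 1 => 2 * (((-f / (2 * e) : ℚ) : ℝ)) - v 0) ∈ r'.domain) →
      EqOn r.integrand (fun v => (γ : ℝ) * √(qD e f g (v 0))) r.domain → InBaker (KZ.of r)) :
    InBaker (KZ.of r') := by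
  set X₀ : ℝ := ((-f / (2 * e) : ℚ) : ℝ) with hX₀def
  have hR : IsSemialgebraicFunOn ℚ (univ : Set (Fin 1 → ℝ))
      fun v => (γ : ℝ) * √(qD e f g (v 0)) :=
    ((isSemialgebraicFunOn_ratCast isSemialgebraic_univ γ).mul_holds
      (IsSemialgebraicFunOn.sqrt_holds (isSemialgebraicFunOn_qD e f g isSemialgebraic_univ))).congr
      fun _ _ => rfl
  have hgS : IsSemialgebraicFunOn ℚ (univ : Set (Fin 1 → ℝ)) fun v => 2 * X₀ - v 0 := by
    refine ((isSemialgebraicFunOn_ratCast isSemialgebraic_univ (2 * (-f / (2 * e)))).sub_holds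
      (isSemialgebraicFunOn_apply isSemialgebraic_univ 0)).congr fun v _ => ?_
    have hc : (((2 * (-f / (2 * e)) : ℚ) : ℝ)) = 2 * X₀ := by rw [hX₀def]; push_cast; ring
    simp only [Pi.sub_apply, hc]
  have hder : ∀ v ∈ (univ : Set (Fin 1 → ℝ)),
      HasDerivAt (fun t : ℝ => 2 * X₀ - t) (-1) (v 0) := fun v _ => by
    simpa using (hasDerivAt_id (v 0)).const_sub (2 * X₀)
  have hinj : ∀ s ∈ (univ : Set (Fin 1 → ℝ)), ∀ t ∈ (univ : Set (Fin 1 → ℝ)),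
      2 * X₀ - s 0 = 2 * X₀ - t 0 → s 0 = t 0 := fun s _ t _ hst => by linarith
  have hsurj : ∀ x ∈ r'.domain, ∃ v ∈ (univ : Set (Fin 1 → ℝ)), 2 * X₀ - v 0 = x 0 :=
    fun x _ => ⟨fun _ => 2 * X₀ - x 0, mem_univ _, by ring⟩
  have hRe : ∀ v ∈ (univ : Set (Fin 1 → ℝ)), lift₁ (fun t : ℝ => 2 * X₀ - t) v ∈ r'.domain →
      (γ : ℝ) * √(qD e f g (v 0)) =
        r'.integrand (lift₁ (fun t : ℝ => 2 * X₀ - t) v) * |(-1 : ℝ)| := fun v _ hvd => by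
    rw [hr' hvd]
    have hlift : lift₁ (fun t : ℝ => 2 * X₀ - t) v 0 = 2 * X₀ - v 0 := rfl
    simp only [hlift, abs_neg, abs_one, mul_one]
    rw [hX₀def, qD_reflect e f g he]
  obtain ⟨r, hrd, hri, hrel⟩ := exists_cov₁ r' isSemialgebraic_univ (fun t : ℝ => 2 * X₀ - t)
    (fun _ => -1) hgS hder hinj hsurj (fun v => (γ : ℝ) * √(qD e f g (v 0))) hR hRe
  have h1 : InBaker (KZ.of r) :=
    h r (fun v hv => by rw [hrd] at hv; exact hv.2) fun v _ => by rw [hri]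
  refine h1.congr ?_
  have : KZ.of r' - KZ.of r = -(KZ.of r - KZ.of r') := by abel
  rw [this]
  exact KZ.relations.neg_mem hrel

/-- For `e ≠ 0` and `h ≤ 0` the vertex `x₀` is not in `{D > 0}`; split the domain at `x₀` and
reflect the left half onto the right (rules (1a), (2)). [this node] -/
theorem InBaker.split_reflect (e f g γ : ℚ) (he : e ≠ 0) (hh : g - f ^ 2 / (4 * e) ≤ 0)
    (r : KZ.IntegralRep 1) (hpos : ∀ v ∈ r.domain, 0 < qD e f g (v 0))
    (hr : EqOn r.integrand (fun v => (γ : ℝ) * √(qD e f g (v 0))) r.domain)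
    (hright : ∀ r₁ : KZ.IntegralRep 1,
      (∀ v ∈ r₁.domain, (((-f / (2 * e) : ℚ) : ℝ)) < v 0 ∧ 0 < qD e f g (v 0)) →
      EqOn r₁.integrand (fun v => (γ : ℝ) * √(qD e f g (v 0))) r₁.domain →
      InBaker (KZ.of r₁)) :
    InBaker (KZ.of r) := by
  set X₀ : ℝ := ((-f / (2 * e) : ℚ) : ℝ) with hX₀def
  have hX₀D : qD e f g X₀ ≤ 0 := by
    have hh' : ((g - f ^ 2 / (4 * e) : ℚ) : ℝ) ≤ 0 := by exact_mod_cast hh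
    rw [qD_eq_vertex e f g he, ← hX₀def]
    simpa using hh'
  set A : Set (Fin 1 → ℝ) := {v | v ∈ r.domain ∧ X₀ < v 0} with hAdef
  set B : Set (Fin 1 → ℝ) := {v | v ∈ r.domain ∧ v 0 < X₀} with hBdef
  have hA : IsSemialgebraic ℚ A := by
    convert IsSemialgebraicFunOn.isSemialgebraic_sep_pos
      ((isSemialgebraicFunOn_apply r.isSemialgebraic_domain 0).sub_holds
        (isSemialgebraicFunOn_ratCast r.isSemialgebraic_domain (-f / (2 * e)))) using 1
    ext v
    simp only [hAdef, mem_setOf_eq, Pi.sub_apply, sub_pos, hX₀def]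
  have hB : IsSemialgebraic ℚ B := by
    convert IsSemialgebraicFunOn.isSemialgebraic_sep_pos
      ((isSemialgebraicFunOn_ratCast r.isSemialgebraic_domain (-f / (2 * e))).sub_holds
        (isSemialgebraicFunOn_apply r.isSemialgebraic_domain 0)) using 1
    ext v
    simp only [hBdef, mem_setOf_eq, Pi.sub_apply, sub_pos, hX₀def]
  have heq : r.domain = A ∪ B := by
    ext v
    simp only [hAdef, hBdef, mem_union, mem_setOf_eq]
    constructor
    · intro hv
      have hne : v 0 ≠ X₀ := fun h => by
        have := hpos v hv
        rw [h] at this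
        exact absurd this (not_lt.2 hX₀D)
      rcases lt_or_gt_of_ne hne with h | h
      · exact Or.inr ⟨hv, h⟩
      · exact Or.inl ⟨hv, h⟩
    · rintro (⟨hv, _⟩ | ⟨hv, _⟩) <;> exact hv
  have hvol : volume (A ∩ B) = 0 := by
    have : A ∩ B = ∅ := by
      ext v
      refine ⟨fun hv => ?_, fun h => h.elim⟩
      have h1 : X₀ < v 0 := hv.1.2
      have h2 : v 0 < X₀ := hv.2.2
      exact False.elim (by linarith)
    rw [this, measure_empty]
  refine InBaker.of_split r hA hB (fun v hv => hv.1) (fun v hv => hv.1) heq hvol ?_ ?_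
  · exact hright _ (fun v hv => ⟨hv.2, hpos v hv.1⟩) fun v hv => hr hv.1
  · refine InBaker.of_reflect e f g γ he _ (fun v hv => hr hv.1) fun r₂ hdom₂ hr₂ =>
      hright r₂ (fun v hv => ?_) hr₂
    have h2 : (fun _ : Fin 1 => 2 * X₀ - v 0) ∈ B := hdom₂ v hv
    obtain ⟨hBd, hBlt⟩ := h2
    have hBlt' : 2 * X₀ - v 0 < X₀ := hBlt
    refine ⟨by linarith, ?_⟩
    have h3 : 0 < qD e f g (2 * X₀ - v 0) := hpos _ hBd
    rw [hX₀def, qD_reflect e f g he] at h3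
    exact h3

end Summit.KontsevichZagierPeriods.RootDecompWalshStrata.ConicDescent

end
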